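import Literature.NumberTheory.Transcendental.EllIterRepShuffle
import Literature.NumberTheory.Transcendental.KZSubcalculusInvariants
import Literature.NumberTheory.Transcendental.KZLogCalculusProofs
import Literature.NumberTheory.Transcendental.KZDominatedFamilyRelations
import Summits.KontsevichZagierPeriods.KontsevichZagierPeriods.Theorems.GenusOneIteratedLegendreLemniscaticBetaUnit
import Summits.KontsevichZagierPeriods.KontsevichZagierPeriods.Theorems.NormalFormPrinciple.Negative.WindowInvariant
import Summits.KontsevichZagierPeriods.KontsevichZagierPeriods.Theorems.MzvKernelInKZ.Negative.PiLine

/-!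
# Route GenusOneIterated — support item `LemniscaticSectorKernel` (stmt-KontsevichZagierPeriods-8548),
# file 3: the one-dimensional letters `ℓ = ⟦∫₁² du/(2u)⟧` and `1 = ⟦∫₀¹ du⟧`

Bookkeeping in the formal period ring `P = KZ.FormalPeriodRing` (`KZRulesAssociator.lean`) for the
one-dimensional representations that the four lemniscatic cruxes of route `GenusOneIterated`
(`KummerLogTwo`, `DepthThreeLemniscatic`, `SecondLyndonLemniscatic`, `LegendreLemniscatic`) put on
their right-hand sides. Everything is stated for representations PINNED by their domain and
integrand (no definition is introduced):

* generic congruences in `P`: equal data (`toFormalPeriod_of_eq_of_eqOn`), integer scaling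
  (`toFormalPeriod_of_constMul_nat'`), integrand additivity (`toFormalPeriod_of_integrandAdd`);
* existence of the pinned one-dimensional representations on `(0,1)` and `(1,2)` with rational
  integrands (`exists_rep_Ioo01`, `exists_logRep`);
* `⟦[(0,1), 1]⟧ = 1` (`toFormalPeriod_oneRep`, one Newton–Leibniz move, through the tree lemma
  `betaFirstOne_constMul_equivalent_unit`);
* the translation `u ↦ 1 + u`: `⟦[(0,1), 1/(2(1+u))]⟧ = ⟦[(1,2), 1/(2v)]⟧ =: ℓ`
  (`toFormalPeriod_halfInvOneAdd`, one change of variables), hence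
  `⟦[(0,1), c/(1+u)]⟧ = 2c · ℓ` for `c = 2, 4`;
* the value `ℓ = ½ log 2` (`logRep_value`).

References: M. Kontsevich, D. Zagier, *Periods* (2001), §1.1–§1.2 (rules (1)–(3)), §4.1.
-/

noncomputable section

open MeasureTheory Set
open Literature.NumberTheory.Transcendental
open Literature.NumberTheory.Transcendental.KZ
open Literature.ModelTheory.ExponentialFields (IsSemialgebraic)
open MvPolynomial (aeval X C)

namespace Summit.KontsevichZagierPeriods.GenusOneIterated.LemniscaticSectorKernel

variable {n : ℕ}

/-! ## Generic congruences in the formal period ring -/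

/-- Representations with the same domain whose integrands agree on it have the same class in `P`
(integrand additivity with a zero representation, `KZ.of_sub_of_mem_relations_of_eqOn`).
[Kontsevich–Zagier 2001, §1.2 rule (1)] -/
theorem toFormalPeriod_of_eq_of_eqOn {r r' : IntegralRep n} (hd : r'.domain = r.domain)
    (h : EqOn r.integrand r'.integrand r.domain) :
    toFormalPeriod (of r) = toFormalPeriod (of r') :=
  toFormalPeriod_eq_iff.mpr (of_sub_of_mem_relations_of_eqOn hd h)

/-- **Integer scaling**: `⟦[σ, k f]⟧ = k · ⟦[σ, f]⟧` in `P` (`k ∈ ℕ`; iterated integrand additivity,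
`KZ.IntegralRep.of_constMul_nat_sub_nsmul_mem_relations`). [Kontsevich–Zagier 2001, §1.2 rule (1)] -/
theorem toFormalPeriod_of_constMul_nat' (r : IntegralRep n) (k : ℕ) :
    toFormalPeriod (of (r.constMul (k : ℝ) (isAlgebraic_nat k))) = (k : FormalPeriodRing) * toFormalPeriod (of r) := by
  have h := toFormalPeriod_eq_zero_of_mem (r.of_constMul_nat_sub_nsmul_mem_relations k)
  rw [map_sub, map_nsmul, sub_eq_zero] at h
  rw [h, nsmul_eq_mul]

/-- **A representation whose integrand is `k` times that of another (same domain) has `k` times its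
class** (`k ∈ ℕ`). [Kontsevich–Zagier 2001, §1.2 rule (1)] -/
theorem toFormalPeriod_of_eq_natMul {r s : IntegralRep n} (k : ℕ) (hd : r.domain = s.domain)
    (h : EqOn r.integrand (fun x => (k : ℝ) * s.integrand x) r.domain) :
    toFormalPeriod (of r) = (k : FormalPeriodRing) * toFormalPeriod (of s) := by
  rw [← toFormalPeriod_of_constMul_nat' s k]
  exact toFormalPeriod_of_eq_of_eqOn (by rw [IntegralRep.domain_constMul, hd]) fun x hx => by
    rw [IntegralRep.integrand_constMul, h hx]

/-- **Integrand additivity in `P`**: if `r`, `r₁`, `r₂` have the same domain and `f = f₁ + f₂` on it,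
then `⟦r⟧ = ⟦r₁⟧ + ⟦r₂⟧`. [Kontsevich–Zagier 2001, §1.2 rule (1)] -/
theorem toFormalPeriod_of_integrandAdd {r r₁ r₂ : IntegralRep n} (h₁ : r₁.domain = r.domain)
    (h₂ : r₂.domain = r.domain) (h : EqOn r.integrand (r₁.integrand + r₂.integrand) r.domain) :
    toFormalPeriod (of r) = toFormalPeriod (of r₁) + toFormalPeriod (of r₂) := by
  have hrel : of r - of r₁ - of r₂ ∈ relations :=
    integrandAddRel_subset_relations ⟨n, r, r₁, r₂, h₁, h₂, h, rfl⟩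
  have h0 := toFormalPeriod_eq_zero_of_mem hrel
  rw [map_sub, map_sub] at h0
  linear_combination h0

/-- A representation over a null domain has class `0`. [Kontsevich–Zagier 2001, §1.2 rule (1)] -/
theorem toFormalPeriod_of_eq_zero_of_volume {r : IntegralRep n} (h : volume r.domain = 0) :
    toFormalPeriod (of r) = 0 :=
  toFormalPeriod_eq_zero_of_mem (of_mem_relations_of_volume_eq_zero r h)

/-- **Restriction to a co-null semialgebraic subset does not change the class.**
[Kontsevich–Zagier 2001, §1.2 rule (1)] -/
theorem toFormalPeriod_of_restrict {r : IntegralRep n} {S : Set (Fin n → ℝ)} (hS : IsSemialgebraic ℚ S)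
    (hSr : S ⊆ r.domain) (hvol : volume (r.domain \ S) = 0) :
    toFormalPeriod (of (r.restrict S hS hSr)) = toFormalPeriod (of r) :=
  (toFormalPeriod_eq_iff.mpr (r.of_sub_of_restrict_mem_relations hS hSr hvol)).symm

/-! ## One-dimensional domains -/

/-- The interval `{1 < x₀ < 2} ⊆ ℝ¹` is `ℚ`-semialgebraic. [folklore] -/
theorem isSemialgebraic_I12 : IsSemialgebraic ℚ {x : Fin 1 → ℝ | 1 < x 0 ∧ x 0 < 2} := by
  simpa using Summit.KontsevichZagierPeriods.MzvKernelInKZ.Negative.sa_Ioo1 1 2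

/-- A function continuous on `[a, b]` is integrable on `{a < x₀ < b} ⊆ ℝ¹`. [folklore] -/
theorem integrableOn_Ioo1_of_continuousOn {g : ℝ → ℝ} {a b : ℝ} (hg : ContinuousOn g (Icc a b)) :
    IntegrableOn (fun x : Fin 1 → ℝ => g (x 0)) {x : Fin 1 → ℝ | a < x 0 ∧ x 0 < b} := by
  have h : {x : Fin 1 → ℝ | a < x 0 ∧ x 0 < b} = {x | x 0 ∈ Ioo a b} := rfl
  rw [h, integrableOn_setOf_apply_mem_iff]
  exact (hg.integrableOn_Icc (μ := volume)).mono_set Ioo_subset_Icc_self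

/-- **Pinned rational representations on `(0,1)` exist**: for polynomials `p, q ∈ ℚ[u]` with `q ≠ 0`
on `[0,1]` there is a representation with domain `{0 < x₀ < 1}` and integrand `x ↦ g (x₀)` whenever
`g = p/q` pointwise and `g` is continuous on `[0,1]`. [Kontsevich–Zagier 2001, §1.1] -/
theorem exists_rep_I01 (g : ℝ → ℝ) (p q : MvPolynomial (Fin 1) ℚ)
    (hq : ∀ x : Fin 1 → ℝ, 0 < x 0 ∧ x 0 < 1 → aeval x q ≠ 0)
    (hg : ∀ x : Fin 1 → ℝ, 0 < x 0 ∧ x 0 < 1 → aeval x p / aeval x q = g (x 0))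
    (hc : ContinuousOn g (Icc 0 1)) :
    ∃ r : IntegralRep 1, r.domain = {x : Fin 1 → ℝ | 0 < x 0 ∧ x 0 < 1} ∧ r.integrand = fun x => g (x 0) :=
  ⟨⟨{x | 0 < x 0 ∧ x 0 < 1}, fun x => g (x 0), isSemialgebraic_unitInterval_fin_one,
    (isSemialgebraicFunOn_aeval_div_aeval isSemialgebraic_unitInterval_fin_one p q fun x hx => hq x hx).congr
      fun x hx => hg x hx,
    integrableOn_Ioo1_of_continuousOn hc⟩, rfl, rfl⟩

/-- **The Kummer letter exists**: `L = [(1,2), 1/(2u)]` (value `½ log 2`), the right-hand side of the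
crux `KummerLogTwo`. [Kontsevich–Zagier 2001, §1.1] -/
theorem exists_logRep :
    ∃ L : IntegralRep 1, L.domain = {x : Fin 1 → ℝ | 1 < x 0 ∧ x 0 < 2} ∧
      L.integrand = fun x => 1 / (2 * x 0) := by
  have hsa : IsSemialgebraicFunOn ℚ {x : Fin 1 → ℝ | 1 < x 0 ∧ x 0 < 2} fun x => 1 / (2 * x 0) := by
    refine (isSemialgebraicFunOn_aeval_div_aeval isSemialgebraic_I12 (1 : MvPolynomial (Fin 1) ℚ)
      (2 * X 0) fun x hx => ?_).congr fun x _ => ?_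
    · simp only [map_mul, map_ofNat, MvPolynomial.aeval_X]
      have : (0:ℝ) < x 0 := by linarith [hx.1]
      positivity
    · simp
  have hi : IntegrableOn (fun x : Fin 1 → ℝ => 1 / (2 * x 0)) {x : Fin 1 → ℝ | 1 < x 0 ∧ x 0 < 2} := by
    refine integrableOn_Ioo1_of_continuousOn (g := fun t => 1 / (2 * t)) ?_
    exact continuousOn_const.div (by fun_prop) fun t ht => by
      have : (0:ℝ) < t := by linarith [ht.1]
      positivity
  exact ⟨⟨_, _, isSemialgebraic_I12, hsa, hi⟩, rfl, rfl⟩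

/-! ## `⟦[(0,1), 1]⟧ = 1` -/

/-- **`⟦[(0,1), 1]⟧ = 1`** in `P`: the representation `[(0,1), 1]` is the Beta representation
`β(1,1)`, and `1 · β(1,1) ∼ [pt, 1]` is the tree lemma `betaFirstOne_constMul_equivalent_unit` (one
Newton–Leibniz move `∫₀¹ dt = 1`). [Kontsevich–Zagier 2001, §1.2 rule (3)] -/
theorem toFormalPeriod_oneRep (U : IntegralRep 1) (hUd : U.domain = {x : Fin 1 → ℝ | 0 < x 0 ∧ x 0 < 1})
    (hUi : U.integrand = fun _ => 1) : toFormalPeriod (of U) = 1 := by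
  have halg : IsAlgebraic ℚ (((1 : ℚ) : ℚ) : ℝ) := isAlgebraic_algebraMap _
  have hU : Equivalent (U.constMul (((1 : ℚ) : ℚ) : ℝ) halg) IntegralRep.unit := by
    refine Summit.KontsevichZagierPeriods.KontsevichZagierPeriods.Theorems.betaFirstOne_constMul_equivalent_unit
      1 one_pos U (by rw [hUd]; rfl) (fun x _ => ?_) halg
    rw [hUi]
    simp
  have h1 : toFormalPeriod (of (U.constMul (((1 : ℚ) : ℚ) : ℝ) halg)) = toFormalPeriod (of U) :=
    toFormalPeriod_of_eq_of_eqOn (by rw [IntegralRep.domain_constMul]) fun x _ => by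
      rw [IntegralRep.integrand_constMul]
      simp
  rw [← h1, hU.toFormalPeriod_eq, toFormalPeriod_of_unit]

/-- **`⟦[(0,1), k]⟧ = k`** for `k ∈ ℕ`. [Kontsevich–Zagier 2001, §1.2 rules (1), (3)] -/
theorem toFormalPeriod_constRep (U : IntegralRep 1) (hUd : U.domain = {x : Fin 1 → ℝ | 0 < x 0 ∧ x 0 < 1})
    (hUi : U.integrand = fun _ => 1) (K : IntegralRep 1)
    (hKd : K.domain = {x : Fin 1 → ℝ | 0 < x 0 ∧ x 0 < 1}) (k : ℕ) (hKi : K.integrand = fun _ => (k : ℝ)) :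
    toFormalPeriod (of K) = (k : FormalPeriodRing) := by
  rw [toFormalPeriod_of_eq_natMul k (hKd.trans hUd.symm) (fun x _ => by simp only [hKi, hUi, mul_one]),
    toFormalPeriod_oneRep U hUd hUi, mul_one]

/-! ## The translation `u ↦ 1 + u` and the letter `ℓ` -/

/-- **`⟦[(0,1), 1/(2(1+u))]⟧ = ⟦[(1,2), 1/(2v)]⟧`**: one change of variables `v = u + 1`
(rule (2): translation of `ℝ¹`, Jacobian `1`). [Kontsevich–Zagier 2001, §1.2 rule (2)] -/
theorem toFormalPeriod_halfInvOneAdd (H : IntegralRep 1)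
    (hHd : H.domain = {x : Fin 1 → ℝ | 0 < x 0 ∧ x 0 < 1})
    (hHi : H.integrand = fun x => 1 / (2 * (1 + x 0)))
    (L : IntegralRep 1) (hLd : L.domain = {x : Fin 1 → ℝ | 1 < x 0 ∧ x 0 < 2})
    (hLi : L.integrand = fun x => 1 / (2 * x 0)) :
    toFormalPeriod (of H) = toFormalPeriod (of L) := by
  refine toFormalPeriod_eq_iff.mpr (changeOfVariablesRel_subset_relations ?_)
  refine ⟨1, H, L, fun x => x + fun _ => (1:ℝ), fun _ => ContinuousLinearMap.id ℝ (Fin 1 → ℝ),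
    ?_, fun x _ => ((hasFDerivAt_id x).add_const _).hasFDerivWithinAt, ?_, ?_, fun x hx => ?_, rfl⟩
  · -- semialgebraic: the polynomial map `X 0 + 1`
    refine (isSemialgebraicMapOn_aeval H.isSemialgebraic_domain (fun _ : Fin 1 => X 0 + 1)).congr ?_
    intro x _
    funext j
    simp [Fin.fin_one_eq_zero j]
  · exact (add_left_injective _).injOn
  · rw [hLd, hHd]
    ext y
    constructor
    · intro hy
      have hy' : 1 < y 0 ∧ y 0 < 2 := hy
      refine ⟨y - fun _ => (1:ℝ), ?_, sub_add_cancel y _⟩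
      refine ⟨?_, ?_⟩ <;> simp only [Pi.sub_apply] <;> linarith [hy'.1, hy'.2]
    · rintro ⟨x, hx, rfl⟩
      have hx' : 0 < x 0 ∧ x 0 < 1 := hx
      refine ⟨?_, ?_⟩ <;> simp only [Pi.add_apply] <;> linarith [hx'.1, hx'.2]
  · have hdet : (ContinuousLinearMap.id ℝ (Fin 1 → ℝ)).det = 1 := by
      rw [ContinuousLinearMap.det, ContinuousLinearMap.coe_id, LinearMap.det_id]
    rw [hHi, hLi, hdet, abs_one, mul_one]
    simp only [Pi.add_apply]
    ring

/-- **`⟦[(0,1), c/(1+u)]⟧ = 2c · ℓ`** for `c ∈ ℕ`, `ℓ = ⟦[(1,2), 1/(2v)]⟧`: scaling by `2c`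
(rule (1)) and the translation (rule (2)). Used with `c = 2` and `c = 4` (`∫₀¹ 4 du/(1+u) = 4 log 2`).
[Kontsevich–Zagier 2001, §1.2 rules (1), (2)] -/
theorem toFormalPeriod_constDivOneAdd (H : IntegralRep 1)
    (hHd : H.domain = {x : Fin 1 → ℝ | 0 < x 0 ∧ x 0 < 1})
    (hHi : H.integrand = fun x => 1 / (2 * (1 + x 0)))
    (L : IntegralRep 1) (hLd : L.domain = {x : Fin 1 → ℝ | 1 < x 0 ∧ x 0 < 2})
    (hLi : L.integrand = fun x => 1 / (2 * x 0)) (c : ℕ) (R : IntegralRep 1)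
    (hRd : R.domain = {x : Fin 1 → ℝ | 0 < x 0 ∧ x 0 < 1})
    (hRi : R.integrand = fun x => (c : ℝ) / (1 + x 0)) :
    toFormalPeriod (of R) = (2 * c : ℕ) * toFormalPeriod (of L) := by
  rw [← toFormalPeriod_halfInvOneAdd H hHd hHi L hLd hLi]
  refine toFormalPeriod_of_eq_natMul (2 * c) (hRd.trans hHd.symm) fun x hx => ?_
  rw [hRd] at hx
  rw [hRi, hHi]
  have : (0:ℝ) < 1 + x 0 := by linarith [hx.1]
  push_cast
  field_simp

/-! ## The value `ℓ = ½ log 2` -/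

/-- **`value [(1,2), 1/(2u)] = ½ log 2`.** [folklore] -/
theorem logRep_value (L : IntegralRep 1) (hLd : L.domain = {x : Fin 1 → ℝ | 1 < x 0 ∧ x 0 < 2})
    (hLi : L.integrand = fun x => 1 / (2 * x 0)) : L.value = Real.log 2 / 2 := by
  rw [IntegralRep.value, hLd, hLi]
  have hdom : {x : Fin 1 → ℝ | 1 < x 0 ∧ x 0 < 2} = {x | x 0 ∈ Ioo (1:ℝ) 2} := rfl
  rw [hdom, Summit.KontsevichZagierPeriods.HurwitzMicroSectors.NormalFormPrinciple.Negative.setIntegral_fin_one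
    (fun x : Fin 1 → ℝ => 1 / (2 * x 0)) (Ioo (1:ℝ) 2)]
  simp only
  rw [← integral_Ioc_eq_integral_Ioo, ← intervalIntegral.integral_of_le (by norm_num : (1:ℝ) ≤ 2)]
  have h : ∫ x in (1:ℝ)..2, 1 / (2 * x) = (1 / 2) * ∫ x in (1:ℝ)..2, x⁻¹ := by
    rw [← intervalIntegral.integral_const_mul]
    refine intervalIntegral.integral_congr fun x _ => ?_
    simp only [one_div, mul_inv]
  rw [h, integral_inv_of_pos one_pos two_pos, div_one]
  ring

end Summit.KontsevichZagierPeriods.GenusOneIterated.LemniscaticSectorKernel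

end
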